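import Summits.NavierStokesRegularity.NavierStokesRegularity.Theorems.LerayQuarterDissipationFiniteDissipationLiouvilleQuietCore
import HarnessLib

/-!
# Crux `FiniteDissipationLiouville` (stmt-NavierStokesRegularity-22144): the ENERGY-QUIET-CORE
# leaf and the CORE ENERGY FLOOR — the kinetic energy of a finite-dissipation Type-I singularity
# in every similarity ball is `≍ √(−t)`, from both sides

Theorems file of route `LerayQuarterDissipation` (lead prover ns-lqd-lead g9; `--supports` the
crux, line `birth`; portrait facts for the registered stub `stub_envelopeCriticalLiouville`).
Navier–Stokes regularity is NOT proved by anything here; no summit is.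

`𝒟_{C,K}`: Type-I ancient mild fields `w` (KNSS gauge, `IsTypeIAncientMild C w`) with Leray's
quarter-rate law `∫ ‖∇w(s)‖² ≤ K/√(−s)`. The kinetic energy of a member in a similarity ball
`B(0, r√(−t))` is at most `Λ(K) r √(−t)` (`…TraceMorrey.lintegral_ball_sq_le_unif`, lead g5: no
energy concentrates at the singular time). This file proves the LOWER companion:

* `quietCoreEnergy_leaf` — **ONE-SLICE ENERGY-QUIET-CORE LEAF**: `∀ C K r > 0, ∃ δ > 0`: a member
  of `𝒟_{C,K}` whose kinetic energy in ONE similarity ball at ONE instant is small,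
  `∫_{B(0, r√(−t))} ‖w(t)‖² ≤ δ √(−t)`, is bounded on a backward cylinder at the origin. This is the
  `L²` currency of the quiet-core leaves of `…QuietCore` (amplitude `L^∞` and dissipation `Ḣ¹`,
  seat ns-lqd-p2 g7) and formally the strongest of the three one-ball statements (a core that is
  small in sup norm is small in energy). Mechanism: scale the instant to `−1`
  (`setLIntegral_ball_nsRescale_sq`: the core energy scales like a length), KNSS compactness across
  members (`Compactness.seqLimit`), persistence of the singularity
  (`Compactness.persistent_singularity_seq`), Fatou on the ball, continuity, space analyticity of
  the slice (`QuietCore.slice_eq_zero_of_eq_zero_on_ball`), forward uniqueness from the zero slice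
  (`CalmSlice.not_singular_of_zero_slice`).
* `coreEnergy_floor_of_singular` — contrapositive, **a portrait clause of the minimal
  counterexample: every SINGULAR member of `𝒟_{C,K}` carries at EVERY instant `t < 0` the energy
  floor `∫_{B(0, r√(−t))} ‖w(t)‖² > δ(C,K,r) √(−t)`.** With lead g5's ceiling, the core energy of a
  finite-dissipation Type-I singularity obeys the TWO-SIDED LAW
  `δ √(−t) < ∫_{B(0,r√(−t))} ‖w(t)‖² ≤ Λ r √(−t)`: it vanishes at the singular time at exactly the
  parabolic rate, from both sides (companion file `…EnergyRemainder`: the singular part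
  `W(t) − u₀` has finite TOTAL energy `≤ M √(−t)`).

HONEST FRAMING. `δ(C,K,r)` comes from compactness (no explicit value); no discretely
self-similar or wandering scenario is removed — portrait facts only. No summit is proved.

References: Koch–Nadirashvili–Seregin–Šverák, Acta Math. 203 (2009) = arXiv:0709.3599, §4
(compactness of the class); Lemarié-Rieusset, *The Navier–Stokes problem in the 21st century*
(2016), Thm 9.12 (space analyticity); Albritton–Barker, arXiv:1811.00502, Prop. 2.3.
-/

noncomputable section

-- the summit and its single sub-problem share the name (CONVENTIONS §1), as in every Theorems file
set_option linter.dupNamespace false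

namespace Summit.NavierStokesRegularity.NavierStokesRegularity.Theorems.FiniteDissipationLiouville.EnergyFloor

open MeasureTheory Set Filter Topology Metric Function
open Literature.Analysis Literature.Analysis.FluidPDE
open Summit.NavierStokesRegularity.NavierStokesRegularity.Theorems.FiniteDissipationLiouville
open Summit.NavierStokesRegularity.NavierStokesRegularity.Theorems
open scoped ENNReal NNReal RealInnerProductSpace

/-! ### Tools: Fatou on a set, scaling of the core energy -/

/-- **Fatou on a set for squared norms** along pointwise convergence with eventual bounds. -/
theorem setLIntegral_sq_le_of_tendsto_of_eventually {S : Set (EuclideanSpace ℝ (Fin 3))}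
    {v : ℕ → EuclideanSpace ℝ (Fin 3) → EuclideanSpace ℝ (Fin 3)}
    {V : EuclideanSpace ℝ (Fin 3) → EuclideanSpace ℝ (Fin 3)} {B : ℝ≥0∞}
    (hmeas : ∀ k, Measurable (v k))
    (hconv : ∀ x, Tendsto (fun k => v k x) atTop (𝓝 (V x)))
    (hle : ∀ᶠ k in atTop, ∫⁻ x in S, ‖v k x‖ₑ ^ 2 ≤ B) :
    ∫⁻ x in S, ‖V x‖ₑ ^ 2 ≤ B := by
  have hpt : ∀ x, Tendsto (fun k => ‖v k x‖ₑ ^ 2) atTop (𝓝 (‖V x‖ₑ ^ 2)) := fun x =>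
    ((ENNReal.continuous_pow 2).tendsto _).comp ((continuous_enorm.tendsto _).comp (hconv x))
  have e : (fun x => ‖V x‖ₑ ^ 2) = fun x => liminf (fun k => ‖v k x‖ₑ ^ 2) atTop :=
    funext fun x => ((hpt x).liminf_eq).symm
  have hmeas' : ∀ k, AEMeasurable (fun x => ‖v k x‖ₑ ^ 2) (volume.restrict S) := fun k =>
    ((hmeas k).enorm.pow_const 2).aemeasurable
  calc ∫⁻ x in S, ‖V x‖ₑ ^ 2
      = ∫⁻ x in S, liminf (fun k => ‖v k x‖ₑ ^ 2) atTop := by rw [e]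
    _ ≤ liminf (fun k => ∫⁻ x in S, ‖v k x‖ₑ ^ 2) atTop := lintegral_liminf_le' hmeas'
    _ ≤ B := liminf_le_of_frequently_le' hle.frequently

/-- **Scaling of the core energy**: `∫_{B(0,r)} ‖w_c(s)‖² = c⁻¹ ∫_{B(0,c r)} ‖w(c²s)‖²` for
`w_c(s,x) = c w(c²s, cx)`, `c > 0` (the substitution `y = cx`; the kinetic energy in similarity
balls scales like a length). [cite: KochNadirashviliSereginSverak2009, §1 (1.2) (arXiv:0709.3599 p. 2)] -/
theorem setLIntegral_ball_nsRescale_sq {c : ℝ} (hc : 0 < c)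
    (u : ℝ → EuclideanSpace ℝ (Fin 3) → EuclideanSpace ℝ (Fin 3)) (s r : ℝ) :
    ∫⁻ x in ball (0 : EuclideanSpace ℝ (Fin 3)) r, ‖nsRescale c u s x‖ₑ ^ 2 =
      ENNReal.ofReal c⁻¹ *
        ∫⁻ y in ball (0 : EuclideanSpace ℝ (Fin 3)) (c * r), ‖u (c ^ 2 * s) y‖ₑ ^ 2 := by
  have hc0 : c ≠ 0 := hc.ne'
  set G : EuclideanSpace ℝ (Fin 3) → ℝ≥0∞ :=
    (ball (0 : EuclideanSpace ℝ (Fin 3)) (c * r)).indicator fun y => ‖u (c ^ 2 * s) y‖ₑ ^ 2 with hG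
  have e1 : ∀ x, (ball (0 : EuclideanSpace ℝ (Fin 3)) r).indicator
      (fun x => ‖nsRescale c u s x‖ₑ ^ 2) x = ENNReal.ofReal (c ^ 2) * G (c • x + 0) := by
    intro x
    rw [add_zero]
    by_cases hx : x ∈ ball (0 : EuclideanSpace ℝ (Fin 3)) r
    · have hcx : c • x ∈ ball (0 : EuclideanSpace ℝ (Fin 3)) (c * r) := by
        rw [mem_ball_zero_iff] at hx ⊢
        rw [norm_smul, Real.norm_of_nonneg hc.le]
        exact mul_lt_mul_of_pos_left hx hc
      rw [indicator_of_mem hx, hG, indicator_of_mem hcx, nsRescale_apply, enorm_smul, mul_pow]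
      congr 1
      rw [Real.enorm_eq_ofReal hc.le, ← ENNReal.ofReal_pow hc.le]
    · have hcx : c • x ∉ ball (0 : EuclideanSpace ℝ (Fin 3)) (c * r) := by
        rw [mem_ball_zero_iff] at hx ⊢
        rw [norm_smul, Real.norm_of_nonneg hc.le]
        intro h
        exact hx (lt_of_mul_lt_mul_left h hc.le)
      rw [indicator_of_notMem hx, hG, indicator_of_notMem hcx, mul_zero]
  have hL : ∫⁻ x in ball (0 : EuclideanSpace ℝ (Fin 3)) r, ‖nsRescale c u s x‖ₑ ^ 2 =
      ∫⁻ x, (ball (0 : EuclideanSpace ℝ (Fin 3)) r).indicator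
        (fun x => ‖nsRescale c u s x‖ₑ ^ 2) x :=
    (lintegral_indicator measurableSet_ball _).symm
  have hR : ∫⁻ y in ball (0 : EuclideanSpace ℝ (Fin 3)) (c * r), ‖u (c ^ 2 * s) y‖ₑ ^ 2 =
      ∫⁻ y, G y := by
    rw [hG]; exact (lintegral_indicator measurableSet_ball _).symm
  rw [hL, hR]
  simp_rw [e1]
  rw [lintegral_const_mul' _ _ ENNReal.ofReal_ne_top, PoincareBall.lintegral_comp_smul_add G hc0 0,
    ← mul_assoc, finrank_euclideanSpace, Fintype.card_fin]
  congr 1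
  rw [← ENNReal.ofReal_mul (by positivity)]
  congr 1
  rw [abs_of_pos (by positivity)]
  field_simp

/-! ### The compactness core -/

/-- **No sequence of singular members of `𝒟_{C,K}` has asymptotically vanishing core ENERGY at
`t = −1` on a fixed ball** (KNSS compactness across members, persistence of the singularity, Fatou
on the ball, continuity, analyticity, forward uniqueness from the zero slice). [cite: KochNadirashviliSereginSverak2009, §4 (arXiv:0709.3599 p. 8)] -/
theorem false_of_quietCoreEnergy_seq {C K r : ℝ} (hr : 0 < r)
    {w : ℕ → ℝ → EuclideanSpace ℝ (Fin 3) → EuclideanSpace ℝ (Fin 3)}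
    (hwk : ∀ k, IsTypeIAncientMild C (w k))
    (hlaw : ∀ k, ∀ s : ℝ, s < 0 →
      ∫⁻ x, ‖fderiv ℝ (w k s) x‖ₑ ^ 2 ≤ ENNReal.ofReal (K / Real.sqrt (-s)))
    (hsing : ∀ k, ∀ ρ > 0, ∀ M : ℝ, ∃ t ∈ Ioo (-(ρ ^ 2)) (0 : ℝ),
      ∃ x ∈ ball (0 : EuclideanSpace ℝ (Fin 3)) ρ, M < ‖w k t x‖)
    (hquiet : ∀ k, ∫⁻ x in ball (0 : EuclideanSpace ℝ (Fin 3)) r, ‖w k (-1) x‖ₑ ^ 2 ≤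
      ENNReal.ofReal (1 / ((k : ℝ) + 1))) :
    False := by
  obtain ⟨ψ, hψ, W, hW, hunif, hpt, -⟩ := Compactness.seqLimit hwk
  have hψt : Tendsto ψ atTop atTop := hψ.tendsto_atTop
  have hWsing := Compactness.persistent_singularity_seq (w := fun j => w (ψ j))
    (fun j => hwk (ψ j)) (fun j => hlaw (ψ j)) (fun j => hsing (ψ j)) hW hunif
  have h1 : (-1 : ℝ) < 0 := by norm_num
  -- Fatou on the ball: the limit slice carries no energy on `B(0, r)`
  have hzero : ∫⁻ x in ball (0 : EuclideanSpace ℝ (Fin 3)) r, ‖W (-1) x‖ₑ ^ 2 = 0 := by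
    refine le_antisymm (ENNReal.le_of_forall_pos_le_add fun ε hε _ => ?_) bot_le
    rw [zero_add, ← ENNReal.ofReal_coe_nnreal]
    refine setLIntegral_sq_le_of_tendsto_of_eventually
      (fun j => ((hwk (ψ j)).continuous_slice h1).measurable) (hpt (-1) h1) ?_
    have hεpos : (0 : ℝ) < ε := by exact_mod_cast hε
    obtain ⟨N, hN⟩ := exists_nat_gt (1 / (ε : ℝ))
    filter_upwards [hψt.eventually_ge_atTop N] with j hj
    refine (hquiet (ψ j)).trans (ENNReal.ofReal_le_ofReal ?_)
    have hj' : (N : ℝ) ≤ (ψ j : ℝ) := by exact_mod_cast hj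
    have h2 : 1 / (ε : ℝ) < (ψ j : ℝ) + 1 := by linarith
    rw [div_le_iff₀ (by positivity)]
    have := (div_lt_iff₀ hεpos).1 h2
    linarith
  -- a.e. zero on the ball, hence zero on the ball (continuity)
  have hmeas : AEMeasurable (fun x => ‖W (-1) x‖ₑ ^ 2)
      (volume.restrict (ball (0 : EuclideanSpace ℝ (Fin 3)) r)) :=
    ((hW.continuous_slice h1).measurable.enorm.pow_const 2).aemeasurable
  have hae : ∀ᵐ x ∂(volume.restrict (ball (0 : EuclideanSpace ℝ (Fin 3)) r)),
      ‖W (-1) x‖ₑ ^ 2 = 0 := (lintegral_eq_zero_iff' hmeas).1 hzero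
  have hae' : W (-1) =ᵐ[volume.restrict (ball (0 : EuclideanSpace ℝ (Fin 3)) r)]
      fun _ => (0 : EuclideanSpace ℝ (Fin 3)) := by
    filter_upwards [hae] with x hx
    have hx' : ‖W (-1) x‖ₑ = 0 := (pow_eq_zero_iff two_ne_zero).mp hx
    exact enorm_eq_zero.1 hx'
  have hball : ∀ x ∈ ball (0 : EuclideanSpace ℝ (Fin 3)) r, W (-1) x = 0 := fun x hx =>
    Measure.eqOn_open_of_ae_eq hae' isOpen_ball (hW.continuous_slice h1).continuousOn
      continuousOn_const hx
  have hslice : ∀ x, W (-1) x = 0 := QuietCore.slice_eq_zero_of_eq_zero_on_ball hW h1 hr hball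
  exact CalmSlice.not_singular_of_zero_slice hW h1 hslice hWsing

/-! ### The one-slice energy-quiet-core leaf and the core energy floor -/

/-- **ONE-SLICE ENERGY-QUIET-CORE LEAF.** `∀ C K r > 0, ∃ δ > 0`: a member of `𝒟_{C,K}` with
`∫_{B(0, r√(−t))} ‖w(t)‖² ≤ δ √(−t)` at ONE instant `t < 0` is bounded on some backward cylinder at
the origin (scale the instant to `−1` by `setLIntegral_ball_nsRescale_sq`, then
`false_of_quietCoreEnergy_seq`). The `L²` form of the quiet-core leaves of `…QuietCore`. [cite: KochNadirashviliSereginSverak2009, §4 (arXiv:0709.3599 p. 8)] [cite: LemarieRieusset2016, Thm. 9.12 (PDF p. 260)] -/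
theorem quietCoreEnergy_leaf : ∀ (C K r : ℝ), 0 < r → ∃ δ > 0,
    ∀ (w : ℝ → EuclideanSpace ℝ (Fin 3) → EuclideanSpace ℝ (Fin 3)),
      IsTypeIAncientMild C w →
      (∀ s : ℝ, s < 0 → ∫⁻ x, ‖fderiv ℝ (w s) x‖ₑ ^ 2 ≤ ENNReal.ofReal (K / Real.sqrt (-s))) →
      (∃ t < 0, ∫⁻ x in ball (0 : EuclideanSpace ℝ (Fin 3)) (r * Real.sqrt (-t)), ‖w t x‖ₑ ^ 2 ≤
        ENNReal.ofReal (δ * Real.sqrt (-t))) →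
      ¬ (∀ ρ > 0, ∀ M : ℝ, ∃ t ∈ Ioo (-(ρ ^ 2)) (0 : ℝ),
        ∃ x ∈ ball (0 : EuclideanSpace ℝ (Fin 3)) ρ, M < ‖w t x‖) := by
  intro C K r hr
  by_contra hcon
  push Not at hcon
  choose w' hw' hlaw' hq' hsing' using hcon
  choose t' ht' hq' using hq'
  have hpos : ∀ k : ℕ, (0 : ℝ) < 1 / ((k : ℝ) + 1) := fun k => by positivity
  set w : ℕ → ℝ → EuclideanSpace ℝ (Fin 3) → EuclideanSpace ℝ (Fin 3) :=
    fun k => w' _ (hpos k) with hw_def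
  have hw : ∀ k, IsTypeIAncientMild C (w k) := fun k => hw' _ (hpos k)
  have hlaw := fun k => hlaw' _ (hpos k)
  have hsing := fun k => hsing' _ (hpos k)
  set t : ℕ → ℝ := fun k => t' _ (hpos k) with ht_def
  have ht : ∀ k, t k < 0 := fun k => ht' _ (hpos k)
  have hq := fun k => hq' _ (hpos k)
  set c : ℕ → ℝ := fun k => Real.sqrt (-t k) with hc_def
  have hc : ∀ k, 0 < c k := fun k => Real.sqrt_pos.2 (neg_pos.2 (ht k))
  set v : ℕ → ℝ → EuclideanSpace ℝ (Fin 3) → EuclideanSpace ℝ (Fin 3) :=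
    fun k => nsRescale (c k) (w k) with hv_def
  have hv : ∀ k, IsTypeIAncientMild C (v k) := fun k => isTypeIAncientMild_nsRescale (hw k) (hc k)
  have hvlaw : ∀ k, ∀ s : ℝ, s < 0 →
      ∫⁻ x, ‖fderiv ℝ (v k s) x‖ₑ ^ 2 ≤ ENNReal.ofReal (K / Real.sqrt (-s)) :=
    fun k => RecurrentReductionD.dissipationLaw_nsRescale (hlaw k) (hc k)
  have hvsing : ∀ k, ∀ ρ > 0, ∀ M : ℝ, ∃ t ∈ Ioo (-(ρ ^ 2)) (0 : ℝ),
      ∃ x ∈ ball (0 : EuclideanSpace ℝ (Fin 3)) ρ, M < ‖v k t x‖ :=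
    fun k => RecurrentReductionD.singularAtOrigin_nsRescale (hsing k) (hc k)
  have hvquiet : ∀ k, ∫⁻ x in ball (0 : EuclideanSpace ℝ (Fin 3)) r, ‖v k (-1) x‖ₑ ^ 2 ≤
      ENNReal.ofReal (1 / ((k : ℝ) + 1)) := by
    intro k
    have e : c k ^ 2 * (-1 : ℝ) = t k := by
      rw [hc_def]; dsimp only; rw [Real.sq_sqrt (neg_nonneg.2 (ht k).le)]; ring
    have er : c k * r = r * Real.sqrt (-t k) := by rw [hc_def, mul_comm]
    rw [hv_def]
    dsimp only
    rw [setLIntegral_ball_nsRescale_sq (hc k), e, er]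
    calc ENNReal.ofReal (c k)⁻¹ * ∫⁻ y in ball (0 : EuclideanSpace ℝ (Fin 3)) (r * Real.sqrt (-t k)),
          ‖w k (t k) y‖ₑ ^ 2
        ≤ ENNReal.ofReal (c k)⁻¹ * ENNReal.ofReal ((1 / ((k : ℝ) + 1)) * Real.sqrt (-t k)) := by
          gcongr
          exact hq k
      _ = ENNReal.ofReal (1 / ((k : ℝ) + 1)) := by
          rw [← ENNReal.ofReal_mul (inv_nonneg.2 (hc k).le)]
          congr 1
          rw [hc_def]
          dsimp only
          have hck : Real.sqrt (-t k) ≠ 0 := (hc k).ne'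
          field_simp
  exact false_of_quietCoreEnergy_seq hr hv hvlaw hvsing hvquiet

/-- **CORE ENERGY FLOOR OF A FINITE-DISSIPATION TYPE-I SINGULARITY** (portrait clause of the
registered stub `stub_envelopeCriticalLiouville`): `∀ C K r > 0, ∃ δ > 0` such that every SINGULAR
member of `𝒟_{C,K}` has, at EVERY instant `t < 0`, kinetic energy
`∫_{B(0, r√(−t))} ‖w(t)‖² > δ √(−t)` in the similarity ball (contrapositive of
`quietCoreEnergy_leaf`). With `…TraceMorrey.lintegral_ball_sq_le_unif` (lead g5) the core energy
obeys the two-sided law `δ √(−t) < ∫_{B(0,r√(−t))} ‖w(t)‖² ≤ Λ r √(−t)`. [cite: KochNadirashviliSereginSverak2009, §4 (arXiv:0709.3599 p. 8)] -/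
theorem coreEnergy_floor_of_singular : ∀ (C K r : ℝ), 0 < r → ∃ δ > 0,
    ∀ (w : ℝ → EuclideanSpace ℝ (Fin 3) → EuclideanSpace ℝ (Fin 3)),
      IsTypeIAncientMild C w →
      (∀ s : ℝ, s < 0 → ∫⁻ x, ‖fderiv ℝ (w s) x‖ₑ ^ 2 ≤ ENNReal.ofReal (K / Real.sqrt (-s))) →
      (∀ ρ > 0, ∀ M : ℝ, ∃ t ∈ Ioo (-(ρ ^ 2)) (0 : ℝ),
        ∃ x ∈ ball (0 : EuclideanSpace ℝ (Fin 3)) ρ, M < ‖w t x‖) →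
      ∀ t < 0, ENNReal.ofReal (δ * Real.sqrt (-t)) <
        ∫⁻ x in ball (0 : EuclideanSpace ℝ (Fin 3)) (r * Real.sqrt (-t)), ‖w t x‖ₑ ^ 2 := by
  intro C K r hr
  obtain ⟨δ, hδ, h⟩ := quietCoreEnergy_leaf C K r hr
  refine ⟨δ, hδ, fun w hw hlaw hsing t ht => ?_⟩
  by_contra hle
  push Not at hle
  exact h w hw hlaw ⟨t, ht, hle⟩ hsing

end Summit.NavierStokesRegularity.NavierStokesRegularity.Theorems.FiniteDissipationLiouville.EnergyFloor

end
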